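import Summits.AnomalousDissipation.AnomalousDissipation.Theorems.MirrorVarietyTaylorGreenLoudGalerkinStatesStubTgForceRegular
import Summits.AnomalousDissipation.AnomalousDissipation.Theorems.MirrorVarietyTaylorGreenLoudGalerkinStatesStubCriticality
import Summits.AnomalousDissipation.AnomalousDissipation.Theorems.MirrorVarietyTaylorGreenLoudGalerkinStatesStubGalerkinNewton

/-!
# The amplitude gauge of the line `stagnation-plug-froth` — the lead's glue
# (crux stmt-AnomalousDissipation-2987, `MirrorVariety.TaylorGreenLoudGalerkinStates`)

Kernel-checked composition of the lead's v4 reshape of the line's heart `stub_froth` (skeleton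
`Cruxes/TaylorGreenLoudGalerkinStates/Lines/stagnation_plug_froth.lean`).  In the AMPLITUDE GAUGE (idea card
`Cruxes/TaylorGreenLoudGalerkinStates/Ideas/frozen-cell-amplitude-gauge.md`) a `K`-symmetric steady Taylor–Green state is written
`2•f_TG + v` with `v ⊥ f_TG` (`‖2f_TG‖_{L²} = 1`, `Δf_TG = −12π²f_TG`), the viscosity floats and the force amplitude is RECOVERED from
the energy identity (`2ν(12π² + ‖∇v‖²)`); the exact covariance `(U, ν, f) ↦ (U/s, ν/s, f/s²)` of the tested steady form maps such a
frozen-cell solution to a steady state of the crux's literal force.  This file proves, by real arithmetic only: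

* `stub_froth_of_gauge` — the registered heart `stub_froth` of the line (Newton data along `ν_j → 0⁺`, here with `η_j = 0`) follows
  from the five registered v4 stubs taken as HYPOTHESES, verbatim: `stub_gaugeHeart` (bounded, non-work-free, `K`-nondegenerate
  frozen-cell solutions along gauge viscosities `ν_j → 0⁺`), `stub_automaticLoudness` (`ν‖∇v‖² ≤ 100(√C + C)`),
  `stub_gaugeForward` (frozen-cell equations ⇒ full `K`-tested equations with force `2ν(12π² + ‖∇v‖²)•f_TG`), `stub_gaugeNorms`
  (`∫|2f+v|² = 1 + ∫|v|²`, `‖∇(2f+v)‖² = 12π² + ‖∇v‖²`), `stub_scaling` (covariance);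
* `TaylorGreenLoudGalerkinStates_of_gauge` — hence, with the LANDED `stub_galerkinNewton`, `stub_criticality`, `stub_tgForceRegular`
  and the landed composition `TaylorGreenLoudGalerkinStates_of`, the five v4 stubs imply the crux BY NAME.

A CONDITIONAL result (credits the item only when the five stubs land; four are true and S–M sized, `stub_gaugeHeart` is the crux's
open content).  Constants: physical viscosity `ν_j/s_j`, state `s_j⁻¹•(2f_TG + v_j)`, `s_j = √(2ν_j(12π² + ‖∇v_j‖²)) ∈ [√(2c), √L]`,
`L = 24π²B + 200(√C + C) + 1` (`B` a bound of the gauge viscosities), `E₁ = (1 + C)/(2c)`, `ε₁ = 1/(2√L)`, inf-sup constants `M_j s_j`.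
References: the idea card above; Temam, *Navier–Stokes Equations* (1979) Ch. II §1 (tested steady form, scaling).
-/

-- `Summit.<Summit>.<Problem>` is the tree's mandated summit-side namespace (CONVENTIONS §2); for this
-- single-conjunct summit the two coincide, so the duplicate is deliberate.
set_option linter.dupNamespace false

noncomputable section

open scoped BigOperators Topology InnerProductSpace
open Filter MeasureTheory
open Literature.Analysis.FunctionSpaces Literature.Analysis.FunctionSpaces.Torus

namespace Summit.AnomalousDissipation.AnomalousDissipation.Theorems.TaylorGreenLoudGalerkinStates.Gauge

open Summit.AnomalousDissipation.AnomalousDissipation.Theorems.TaylorGreenLoudGalerkinStates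
open Summit.AnomalousDissipation.AnomalousDissipation.Theorems.TaylorGreenLoudGalerkinStates.Negative

/-- A real sequence tending to `0` is bounded above by a positive constant. [folklore] -/
theorem exists_pos_bound_of_tendsto {ν : ℕ → ℝ} (h : Filter.Tendsto ν Filter.atTop (nhds 0)) :
    ∃ B : ℝ, 0 < B ∧ ∀ j, ν j ≤ B := by
  obtain ⟨b, hb⟩ := h.bddAbove_range
  refine ⟨max b 1, lt_max_of_lt_right one_pos, fun j => ?_⟩
  exact (hb ⟨j, rfl⟩).trans (le_max_left _ _)

/-- **The glue `stub_froth_of_gauge`.**  From the heart and the dictionary: for every Kantorovich threshold `c₀ > 0` the froth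
Newton data exist, with `η_j = 0` (exact states), physical viscosities `ν_j/s_j`, states `s_j⁻¹•(2f_TG + v_j)`,
`s_j = √(2ν_j(12π² + ‖∇v_j‖²))`, `E₁ = (1 + C)/(2c)`, `ε₁ = 1/(2√(24π²B + 200(√C + C) + 1))` (`B` a bound of the gauge
viscosities) and inf-sup constants `M_j s_j`. [folklore] -/
theorem stub_froth_of_gauge
    (hheart : ∃ (ν : ℕ → ℝ) (v : ℕ → UnitAddTorus (Fin 3) → EuclideanSpace ℝ (Fin 3)) (C c : ℝ) (M : ℕ → ℝ),
      (∀ j, 0 < ν j) ∧ Filter.Tendsto ν Filter.atTop (nhds 0) ∧ 0 < c ∧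
      ∀ j, IsKField (v j) ∧ (∫ x, inner ℝ (tgForce x) (v j x)) = 0 ∧
        (∀ b, IsKField b → (∫ x, inner ℝ (tgForce x) (b x)) = 0 →
          testedForm (ν j) tgForce ((2 : ℝ) • tgForce + v j) b = 0) ∧
        ∫ x, ‖v j x‖ ^ 2 ≤ C ∧ c ≤ ν j * gradNormSq (v j) ∧
        (∀ w, IsKField w → ∃ a, IsKField a ∧
            Real.sqrt (gradNormSq w) * Real.sqrt (gradNormSq a) ≤ M j * linForm (ν j) ((2 : ℝ) • tgForce + v j) w a ∧
            (0 < gradNormSq w → 0 < gradNormSq a)))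
    (hloudA : ∀ (ν C : ℝ) (v : UnitAddTorus (Fin 3) → EuclideanSpace ℝ (Fin 3)), 0 < ν → 0 ≤ C → IsKField v →
      (∫ x, inner ℝ (tgForce x) (v x)) = 0 →
      (∀ b, IsKField b → (∫ x, inner ℝ (tgForce x) (b x)) = 0 →
        testedForm ν tgForce ((2 : ℝ) • tgForce + v) b = 0) →
      ∫ x, ‖v x‖ ^ 2 ≤ C → ν * gradNormSq v ≤ 100 * (Real.sqrt C + C))
    (hfwd : ∀ (ν : ℝ) (v : UnitAddTorus (Fin 3) → EuclideanSpace ℝ (Fin 3)), IsKField v →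
      (∫ x, inner ℝ (tgForce x) (v x)) = 0 →
      (∀ b, IsKField b → (∫ x, inner ℝ (tgForce x) (b x)) = 0 →
        testedForm ν tgForce ((2 : ℝ) • tgForce + v) b = 0) →
      ∀ a, IsKField a →
        testedForm ν ((2 * ν * (12 * Real.pi ^ 2 + gradNormSq v)) • tgForce) ((2 : ℝ) • tgForce + v) a = 0)
    (hnorms : ∀ v : UnitAddTorus (Fin 3) → EuclideanSpace ℝ (Fin 3), IsKField v →
      (∫ x, inner ℝ (tgForce x) (v x)) = 0 →
      IsKField ((2 : ℝ) • tgForce + v) ∧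
        (∫ x, ‖((2 : ℝ) • tgForce + v) x‖ ^ 2) = 1 + ∫ x, ‖v x‖ ^ 2 ∧
        gradNormSq ((2 : ℝ) • tgForce + v) = 12 * Real.pi ^ 2 + gradNormSq v)
    (hscal : ∀ (s ν : ℝ) (g U : UnitAddTorus (Fin 3) → EuclideanSpace ℝ (Fin 3)), 0 < s → IsSmooth g → IsSmooth U →
      (∀ a, IsSmooth a → testedForm (ν / s) ((1 / s ^ 2) • g) ((1 / s) • U) a = (1 / s ^ 2) * testedForm ν g U a) ∧
      (∀ w a, IsSmooth w → IsSmooth a → linForm (ν / s) ((1 / s) • U) w a = (1 / s) * linForm ν U w a) ∧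
      gradNormSq ((1 / s) • U) = (1 / s) ^ 2 * gradNormSq U ∧
      (∫ x, ‖((1 / s) • U) x‖ ^ 2) = (1 / s) ^ 2 * ∫ x, ‖U x‖ ^ 2 ∧
      (IsKField U → IsKField ((1 / s) • U))) :
    ∀ c₀ : ℝ, 0 < c₀ →
      ∃ (ν : ℕ → ℝ) (v : ℕ → UnitAddTorus (Fin 3) → EuclideanSpace ℝ (Fin 3)) (E₁ ε₁ : ℝ) (η M : ℕ → ℝ),
        (∀ j, 0 < ν j) ∧ Filter.Tendsto ν Filter.atTop (nhds 0) ∧ 0 < ε₁ ∧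
        ∀ j, IsKField (v j) ∧ ∫ x, ‖v j x‖ ^ 2 ≤ E₁ ∧ ε₁ ≤ ν j * gradNormSq (v j) ∧
          (∀ a, IsKField a → |testedForm (ν j) tgForce (v j) a| ≤ η j * Real.sqrt (gradNormSq a)) ∧
          (∀ w, IsKField w → ∃ a, IsKField a ∧
              Real.sqrt (gradNormSq w) * Real.sqrt (gradNormSq a) ≤ M j * linForm (ν j) (v j) w a ∧
              (0 < gradNormSq w → 0 < gradNormSq a)) ∧
          M j ^ 2 * η j ≤ c₀ ∧ (M j * η j) ^ 2 ≤ c₀ * E₁ ∧ ν j * (M j * η j) ^ 2 ≤ c₀ * ε₁ := by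
  intro c₀ hc₀
  obtain ⟨ν, v, C, c, M, hνpos, hνlim, hc, hj⟩ := hheart
  obtain ⟨B, hBpos, hB⟩ := exists_pos_bound_of_tendsto hνlim
  -- names for the per-`j` quantities
  set U : ℕ → UnitAddTorus (Fin 3) → EuclideanSpace ℝ (Fin 3) := fun j => (2 : ℝ) • tgForce + v j with hU
  set β : ℕ → ℝ := fun j => 2 * ν j * (12 * Real.pi ^ 2 + gradNormSq (v j)) with hβ
  set s : ℕ → ℝ := fun j => Real.sqrt (β j) with hs
  set A : ℝ := 100 * (Real.sqrt C + C) with hA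
  set L : ℝ := 24 * Real.pi ^ 2 * B + 2 * A + 1 with hL
  -- facts at each `j`
  have hvK : ∀ j, IsKField (v j) := fun j => (hj j).1
  have hvperp : ∀ j, (∫ x, inner ℝ (tgForce x) (v j x)) = 0 := fun j => (hj j).2.1
  have hcell : ∀ j, ∀ b, IsKField b → (∫ x, inner ℝ (tgForce x) (b x)) = 0 →
      testedForm (ν j) tgForce ((2 : ℝ) • tgForce + v j) b = 0 := fun j => (hj j).2.2.1
  have hvC : ∀ j, ∫ x, ‖v j x‖ ^ 2 ≤ C := fun j => (hj j).2.2.2.1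
  have hvc : ∀ j, c ≤ ν j * gradNormSq (v j) := fun j => (hj j).2.2.2.2.1
  have hinf : ∀ j, ∀ w, IsKField w → ∃ a, IsKField a ∧
      Real.sqrt (gradNormSq w) * Real.sqrt (gradNormSq a) ≤ M j * linForm (ν j) ((2 : ℝ) • tgForce + v j) w a ∧
      (0 < gradNormSq w → 0 < gradNormSq a) := fun j => (hj j).2.2.2.2.2
  have hC0 : 0 ≤ C := le_trans (integral_nonneg fun x => by positivity) (hvC 0)
  have hA0 : 0 ≤ A := by positivity
  have hDA : ∀ j, ν j * gradNormSq (v j) ≤ A := fun j =>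
    hloudA (ν j) C (v j) (hνpos j) hC0 (hvK j) (hvperp j) (hcell j) (hvC j)
  have hgrad0 : ∀ j, 0 ≤ gradNormSq (v j) := fun j => gradNormSq_nonneg _
  -- the amplitude `β j = 24π²ν_j + 2 ν_j‖∇v_j‖²` is pinched between `2c` and `L`
  have hβlow : ∀ j, 2 * c ≤ β j := fun j => by
    have h1 := hvc j
    have h2 : 0 ≤ 2 * ν j * (12 * Real.pi ^ 2) := by have := (hνpos j).le; positivity
    simp only [hβ]
    nlinarith
  have hβpos : ∀ j, 0 < β j := fun j => lt_of_lt_of_le (by linarith) (hβlow j)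
  have hβle : ∀ j, β j ≤ L := fun j => by
    have h1 := hDA j
    have h2 : ν j * (12 * Real.pi ^ 2) ≤ B * (12 * Real.pi ^ 2) :=
      mul_le_mul_of_nonneg_right (hB j) (by positivity)
    simp only [hβ, hL]
    nlinarith
  have hLpos : 0 < L := by positivity
  have hspos : ∀ j, 0 < s j := fun j => Real.sqrt_pos.2 (hβpos j)
  have hssq : ∀ j, s j ^ 2 = β j := fun j => Real.sq_sqrt (hβpos j).le
  have hsL : ∀ j, s j ≤ Real.sqrt L := fun j => Real.sqrt_le_sqrt (hβle j)
  have hsqrtLpos : 0 < Real.sqrt L := Real.sqrt_pos.2 hLpos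
  -- dictionary facts
  have hUK : ∀ j, IsKField (U j) := fun j => (hnorms (v j) (hvK j) (hvperp j)).1
  have hUen : ∀ j, (∫ x, ‖U j x‖ ^ 2) = 1 + ∫ x, ‖v j x‖ ^ 2 := fun j => (hnorms (v j) (hvK j) (hvperp j)).2.1
  have hUgrad : ∀ j, gradNormSq (U j) = 12 * Real.pi ^ 2 + gradNormSq (v j) := fun j =>
    (hnorms (v j) (hvK j) (hvperp j)).2.2
  have hUsm : ∀ j, IsSmooth (U j) := fun j => (hUK j).1
  have hfull : ∀ j, ∀ a, IsKField a → testedForm (ν j) (β j • tgForce) (U j) a = 0 := fun j a ha =>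
    hfwd (ν j) (v j) (hvK j) (hvperp j) (hcell j) a ha
  have hgsm : ∀ j, IsSmooth (β j • tgForce) := fun j => isSmooth_tgForce.smul (β j)
  -- the rescaled (physical) data
  refine ⟨fun j => ν j / s j, fun j => (1 / s j) • U j, (1 + C) / (2 * c), 1 / (2 * Real.sqrt L),
    fun _ => 0, fun j => M j * s j, fun j => div_pos (hνpos j) (hspos j), ?_, by positivity, fun j => ?_⟩
  · -- `ν_j / s_j → 0`: squeezed between `0` and `ν_j / √(2c)`
    have hs2c : ∀ j, Real.sqrt (2 * c) ≤ s j := fun j => Real.sqrt_le_sqrt (hβlow j)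
    have h2c : 0 < Real.sqrt (2 * c) := Real.sqrt_pos.2 (by linarith)
    have hup : Filter.Tendsto (fun j => ν j / Real.sqrt (2 * c)) Filter.atTop (nhds 0) := by
      simpa using hνlim.div_const (Real.sqrt (2 * c))
    refine tendsto_of_tendsto_of_tendsto_of_le_of_le tendsto_const_nhds hup (fun j => ?_) (fun j => ?_)
    · exact (div_pos (hνpos j) (hspos j)).le
    · exact div_le_div_of_nonneg_left (hνpos j).le h2c (hs2c j)
  · obtain ⟨hT, hLin, hG, hE, hKf⟩ := hscal (s j) (ν j) (β j • tgForce) (U j) (hspos j) (hgsm j) (hUsm j)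
    have hforce : (1 / s j ^ 2) • (β j • tgForce) = tgForce := by
      rw [smul_smul, hssq j, one_div, inv_mul_cancel₀ (hβpos j).ne', one_smul]
    refine ⟨hKf (hUK j), ?_, ?_, ?_, ?_, ?_, ?_, ?_⟩
    · -- energy `(1 + ∫|v|²)/β ≤ (1 + C)/(2c)`
      rw [hE, hUen j]
      have h1 : (1 / s j) ^ 2 * (1 + ∫ x, ‖v j x‖ ^ 2) = (1 + ∫ x, ‖v j x‖ ^ 2) / β j := by
        rw [← hssq j]; field_simp
      rw [h1, div_le_div_iff₀ (hβpos j) (by linarith)]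
      have h2 : 0 ≤ ∫ x, ‖v j x‖ ^ 2 := integral_nonneg fun x => by positivity
      nlinarith [hvC j, hβlow j]
    · -- loudness `(ν/s)·(1/s²)·‖∇U‖² = β/(2 s³) = 1/(2s) ≥ 1/(2√L)`
      rw [hG, hUgrad j]
      have h1 : ν j / s j * ((1 / s j) ^ 2 * (12 * Real.pi ^ 2 + gradNormSq (v j))) = 1 / (2 * s j) := by
        have hβj : β j = 2 * ν j * (12 * Real.pi ^ 2 + gradNormSq (v j)) := rfl
        have hsne : s j ≠ 0 := (hspos j).ne'
        field_simp
        nlinarith [hssq j, hβj]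
      rw [h1]
      exact div_le_div_of_nonneg_left zero_le_one (by have := hspos j; positivity)
        (mul_le_mul_of_nonneg_left (hsL j) zero_le_two)
    · -- residual: exact (`η_j = 0`)
      intro a ha
      rw [zero_mul, abs_nonpos_iff, ← hforce, hT a ha.1, hfull j a ha, mul_zero]
    · -- inf-sup with constant `M_j s_j`
      intro w hw
      obtain ⟨a, ha, hle, hnd⟩ := hinf j w hw
      refine ⟨a, ha, ?_, hnd⟩
      rw [hLin w a hw.1 ha.1]
      have hsne : s j ≠ 0 := (hspos j).ne'
      have : M j * s j * (1 / s j * linForm (ν j) (U j) w a) = M j * linForm (ν j) (U j) w a := by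
        rw [one_div, ← mul_assoc, mul_assoc (M j), mul_inv_cancel₀ hsne, mul_one]
      rw [this]
      exact hle
    · simp only [mul_zero]; exact hc₀.le
    · simp only [mul_zero, zero_pow two_ne_zero]
      exact mul_nonneg hc₀.le (div_nonneg (by linarith) (by linarith))
    · simp only [mul_zero, zero_pow two_ne_zero]
      exact mul_nonneg hc₀.le (by positivity)


/-- **The v4 stubs imply the crux by name.**  The five registered stubs of the gauge reshape (as hypotheses, verbatim) give
`stub_froth` (`stub_froth_of_gauge`), and the landed `stub_galerkinNewton` (Brezzi–Rappaz–Raviart + Newton–Kantorovich),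
`stub_criticality` (Palais) and `stub_tgForceRegular`, composed by the landed `TaylorGreenLoudGalerkinStates_of`, conclude
`MirrorVariety.TaylorGreenLoudGalerkinStates`.  CONDITIONAL on the five hypotheses. [folklore] -/
theorem TaylorGreenLoudGalerkinStates_of_gauge
    (hheart : ∃ (ν : ℕ → ℝ) (v : ℕ → UnitAddTorus (Fin 3) → EuclideanSpace ℝ (Fin 3)) (C c : ℝ) (M : ℕ → ℝ),
      (∀ j, 0 < ν j) ∧ Filter.Tendsto ν Filter.atTop (nhds 0) ∧ 0 < c ∧
      ∀ j, IsKField (v j) ∧ (∫ x, inner ℝ (tgForce x) (v j x)) = 0 ∧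
        (∀ b, IsKField b → (∫ x, inner ℝ (tgForce x) (b x)) = 0 →
          testedForm (ν j) tgForce ((2 : ℝ) • tgForce + v j) b = 0) ∧
        ∫ x, ‖v j x‖ ^ 2 ≤ C ∧ c ≤ ν j * gradNormSq (v j) ∧
        (∀ w, IsKField w → ∃ a, IsKField a ∧
            Real.sqrt (gradNormSq w) * Real.sqrt (gradNormSq a) ≤ M j * linForm (ν j) ((2 : ℝ) • tgForce + v j) w a ∧
            (0 < gradNormSq w → 0 < gradNormSq a)))
    (hloudA : ∀ (ν C : ℝ) (v : UnitAddTorus (Fin 3) → EuclideanSpace ℝ (Fin 3)), 0 < ν → 0 ≤ C → IsKField v →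
      (∫ x, inner ℝ (tgForce x) (v x)) = 0 →
      (∀ b, IsKField b → (∫ x, inner ℝ (tgForce x) (b x)) = 0 →
        testedForm ν tgForce ((2 : ℝ) • tgForce + v) b = 0) →
      ∫ x, ‖v x‖ ^ 2 ≤ C → ν * gradNormSq v ≤ 100 * (Real.sqrt C + C))
    (hfwd : ∀ (ν : ℝ) (v : UnitAddTorus (Fin 3) → EuclideanSpace ℝ (Fin 3)), IsKField v →
      (∫ x, inner ℝ (tgForce x) (v x)) = 0 →
      (∀ b, IsKField b → (∫ x, inner ℝ (tgForce x) (b x)) = 0 →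
        testedForm ν tgForce ((2 : ℝ) • tgForce + v) b = 0) →
      ∀ a, IsKField a →
        testedForm ν ((2 * ν * (12 * Real.pi ^ 2 + gradNormSq v)) • tgForce) ((2 : ℝ) • tgForce + v) a = 0)
    (hnorms : ∀ v : UnitAddTorus (Fin 3) → EuclideanSpace ℝ (Fin 3), IsKField v →
      (∫ x, inner ℝ (tgForce x) (v x)) = 0 →
      IsKField ((2 : ℝ) • tgForce + v) ∧
        (∫ x, ‖((2 : ℝ) • tgForce + v) x‖ ^ 2) = 1 + ∫ x, ‖v x‖ ^ 2 ∧
        gradNormSq ((2 : ℝ) • tgForce + v) = 12 * Real.pi ^ 2 + gradNormSq v)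
    (hscal : ∀ (s ν : ℝ) (g U : UnitAddTorus (Fin 3) → EuclideanSpace ℝ (Fin 3)), 0 < s → IsSmooth g → IsSmooth U →
      (∀ a, IsSmooth a → testedForm (ν / s) ((1 / s ^ 2) • g) ((1 / s) • U) a = (1 / s ^ 2) * testedForm ν g U a) ∧
      (∀ w a, IsSmooth w → IsSmooth a → linForm (ν / s) ((1 / s) • U) w a = (1 / s) * linForm ν U w a) ∧
      gradNormSq ((1 / s) • U) = (1 / s) ^ 2 * gradNormSq U ∧
      (∫ x, ‖((1 / s) • U) x‖ ^ 2) = (1 / s) ^ 2 * ∫ x, ‖U x‖ ^ 2 ∧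
      (IsKField U → IsKField ((1 / s) • U))) :
    Summit.AnomalousDissipation.AnomalousDissipation.Theses.MirrorVariety.TaylorGreenLoudGalerkinStates :=
  TaylorGreenLoudGalerkinStates_of (stub_froth_of_gauge hheart hloudA hfwd hnorms hscal)
    GalerkinNewton.stub_galerkinNewton Criticality.stub_criticality TgForceRegular.stub_tgForceRegular

/-- **Gauge glue, curried form** (the registered sub-goal `gauge_glue` of stmt-AnomalousDissipation-2987): the five registered
stubs of the v4 gauge reshape imply the crux `MirrorVariety.TaylorGreenLoudGalerkinStates` (by `TaylorGreenLoudGalerkinStates_of_gauge`).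
[folklore] -/
theorem gauge_glue : (∃ (ν : ℕ → ℝ) (v : ℕ → UnitAddTorus (Fin 3) → EuclideanSpace ℝ (Fin 3)) (C c : ℝ) (M : ℕ → ℝ), (∀ j, 0 < ν j) ∧ Filter.Tendsto ν Filter.atTop (nhds 0) ∧ 0 < c ∧ ∀ j, IsKField (v j) ∧ (∫ x, inner ℝ (tgForce x) (v j x)) = 0 ∧ (∀ b, IsKField b → (∫ x, inner ℝ (tgForce x) (b x)) = 0 → testedForm (ν j) tgForce ((2 : ℝ) • tgForce + v j) b = 0) ∧ ∫ x, ‖v j x‖ ^ 2 ≤ C ∧ c ≤ ν j * gradNormSq (v j) ∧ (∀ w, IsKField w → ∃ a, IsKField a ∧ Real.sqrt (gradNormSq w) * Real.sqrt (gradNormSq a) ≤ M j * linForm (ν j) ((2 : ℝ) • tgForce + v j) w a ∧ (0 < gradNormSq w → 0 < gradNormSq a))) → (∀ (ν C : ℝ) (v : UnitAddTorus (Fin 3) → EuclideanSpace ℝ (Fin 3)), 0 < ν → 0 ≤ C → IsKField v → (∫ x, inner ℝ (tgForce x) (v x)) = 0 → (∀ b, IsKField b → (∫ x, inner ℝ (tgForce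 x) (b x)) = 0 → testedForm ν tgForce ((2 : ℝ) • tgForce + v) b = 0) → ∫ x, ‖v x‖ ^ 2 ≤ C → ν * gradNormSq v ≤ 100 * (Real.sqrt C + C)) → (∀ (ν : ℝ) (v : UnitAddTorus (Fin 3) → EuclideanSpace ℝ (Fin 3)), IsKField v → (∫ x, inner ℝ (tgForce x) (v x)) = 0 → (∀ b, IsKField b → (∫ x, inner ℝ (tgForce x) (b x)) = 0 → testedForm ν tgForce ((2 : ℝ) • tgForce + v) b = 0) → ∀ a, IsKField a → testedForm ν ((2 * ν * (12 * Real.pi ^ 2 + gradNormSq v)) • tgForce) ((2 : ℝ) • tgForce + v) a = 0) → (∀ v : UnitAddTorus (Fin 3) → EuclideanSpace ℝ (Fin 3), IsKField v → (∫ x, inner ℝ (tgForce x) (v x)) = 0 → IsKField ((2 : ℝ) • tgForce + v) ∧ (∫ x, ‖((2 : ℝ) • tgForce + v) x‖ ^ 2) = 1 + ∫ x, ‖v x‖ ^ 2 ∧ gradNormSq ((2 : ℝ) • tgForce + v) = 12 * Real.pi ^ 2 + gradNormSq v) → (∀ (s ν : ℝ) (g U : UnitAddTorus (Fin 3) → EuclideanSpace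 ℝ (Fin 3)), 0 < s → IsSmooth g → IsSmooth U → (∀ a, IsSmooth a → testedForm (ν / s) ((1 / s ^ 2) • g) ((1 / s) • U) a = (1 / s ^ 2) * testedForm ν g U a) ∧ (∀ w a, IsSmooth w → IsSmooth a → linForm (ν / s) ((1 / s) • U) w a = (1 / s) * linForm ν U w a) ∧ gradNormSq ((1 / s) • U) = (1 / s) ^ 2 * gradNormSq U ∧ (∫ x, ‖((1 / s) • U) x‖ ^ 2) = (1 / s) ^ 2 * ∫ x, ‖U x‖ ^ 2 ∧ (IsKField U → IsKField ((1 / s) • U))) → Summit.AnomalousDissipation.AnomalousDissipation.Theses.MirrorVariety.TaylorGreenLoudGalerkinStates :=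
  fun hheart hloudA hfwd hnorms hscal => TaylorGreenLoudGalerkinStates_of_gauge hheart hloudA hfwd hnorms hscal

end Summit.AnomalousDissipation.AnomalousDissipation.Theorems.TaylorGreenLoudGalerkinStates.Gauge

end
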